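import Literature.NumberTheory.LFunctions.BurnolSonineHardyConverse
import Literature.NumberTheory.LFunctions.BurnolSonineHardyStrip
import Literature.NumberTheory.LFunctions.SonineExtendedMellinContinuation
import Literature.NumberTheory.LFunctions.BurnolZetaHardy
import Literature.Analysis.FunctionSpaces.MellinPlancherelBoundaryValues
import HarnessLib

/-!
# Burnol 2004b Prop. 4.1 (characterisation of `L̂_a`) and Prop. 4.2 (`ζ(s)/(s−ρ)^l ∈ L̂_1`): discharges

LINE 1 — LABEL: RH-FREE (function-theoretic properties of Mellin transforms of Burnol's extended
Sonine spaces `L_a`; Prop. 4.2 puts the functions `ζ(s)/(s−ρ)^l` attached to the non-trivial zeros —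
WHATEVER they are — into `L̂_1`; no hypothesis and no conclusion about their location). FRAMING (cell
rh-crit, D-0074): corpus theorems are RH-FREE literature; nothing here is worded as progress toward RH.
bears_on: B-C/B-P (LADDER-RH COLUMN 6, de Branges framework). WHAT THIS IS NOT: not a route, not a
criterion, no positivity is asserted; nothing here bears on the truth of RH.

Source: J.-F. Burnol, *Two complete and minimal systems associated with the zeros of the Riemann zeta
function*, J. Théor. Nombres Bordeaux 16 (2004) 65–94 = arXiv:math/0203120v7 (`Burnol2004b`), §4
Prop. 4.1 (TeX of record `dbl/src/Burnol2004JTNB_arXivmath0203120v7.tex` l.646–669) and Prop. 4.2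
(l.688–707).

## What is proved (theorems only; no definition, no named fact)

* `Burnol2004b_prop4_1R_ii` — clause (ii) of the repaired Prop. 4.1 `Burnol2004b_prop4_1R`, free
  standing: the (ii′) assembly `BurnolHardyConverse.prop4_1R_ii_of_boundaryValues`
  (`BurnolSonineHardyConverse.lean`: Paley–Wiener in Mellin coordinates, Hardy's inequality, the
  Mellin–Plancherel multiplier identity for the cosine transform, the functional equation on the
  critical line) fed with the Mellin–Plancherel boundary-value lemma
  `MellinL2.mellinL2_ae_eq_of_continuousWithinAt` (`MellinPlancherelBoundaryValues.lean`).
* `Burnol2004b_prop4_1R_ii_fourier` — the same with the `𝓕`-side export `(𝓕f)^ = H` on the strip.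
* `Burnol2004b_prop4_1R_holds : Burnol2004b_prop4_1R` — the repaired Prop. 4.1 AS TYPED: (i) =
  `Burnol2004b_prop4_1R_i` (`BurnolSonineHardyStrip.lean`), (ii) = the above, (iii) =
  `rightMellinExt_pole_and_zeros_of_mem_sonineL` (`SonineExtendedMellinContinuation.lean`).
* `Burnol2004b_prop4_2_holds : Burnol2004b_prop4_2` — Prop. 4.2 AS TYPED, by
  `BurnolZetaHardy.Burnol2004b_prop4_2_of_prop4_1R_ii` (`BurnolZetaHardy.lean`) applied to clause (ii).

(Lemma 4.4, also a one-line consequence of clause (ii) via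
`BurnolSonineHardy.Burnol2004b_lemma4_4_of_prop4_1R_ii`, is already the tree theorem
`Burnol2004b_lemma4_4_holds` of `BurnolSonineChainDensityProofs.lean` by an independent road and is not
re-derived here.)

## References

* J.-F. Burnol, JTNB 16 (2004), Prop. 4.1 and Prop. 4.2 (arXiv:math/0203120v7 pp. 7–8,
  TeX l.633–669, 688–707). [key `Burnol2004b`]
-/

noncomputable section

open MeasureTheory Complex Filter Set Real
open scoped Topology FourierTransform ENNReal

namespace Literature.NumberTheory.LFunctions

open Literature.Analysis.FunctionSpaces

/-- The Mellin–Plancherel boundary-value lemma in the shape consumed by the (ii′) assembly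
(`BurnolHardyConverse.*_of_boundaryValues`): for `k ∈ L²(0,∞)` vanishing a.e. on `(0,a]` whose
Mellin integral agrees on `0 < Re s < ½` with a `K` continuous at the points of the critical line,
`mellinL2 [k] = (ξ ↦ K(½ + 2πiξ))` a.e. — `MellinL2.mellinL2_ae_eq_of_continuousWithinAt` with `δ = ½`
and continuity weakened to continuity from the left half-plane.
[cite: Burnol2004b, §4 (arXiv:math/0203120v7 p. 7, TeX l.626–645)] -/
theorem BurnolHardyConverse.boundaryValues {a : ℝ} (ha : 0 < a) {k : ℝ → ℂ}
    (hk2 : MemLp k 2 (volume.restrict (Ioi (0:ℝ))))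
    (hk0 : ∀ᵐ t ∂(volume.restrict (Ioi (0:ℝ))), t ≤ a → k t = 0) {K : ℂ → ℂ}
    (hK : ∀ s : ℂ, 0 < s.re → s.re < 1 / 2 → mellin k s = K s)
    (hKc : ∀ ξ : ℝ, ContinuousAt K (1 / 2 + 2 * π * ξ * I)) :
    (MellinL2.mellinL2 (hk2.toLp k) : ℝ → ℂ) =ᵐ[volume] fun ξ : ℝ ↦ K (1 / 2 + 2 * π * ξ * I) :=
  MellinL2.mellinL2_ae_eq_of_continuousWithinAt hk2 ha hk0 (δ := 1 / 2) one_half_pos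
    (fun s hs1 hs2 ↦ hK s (by linarith) hs2)
    (Eventually.of_forall fun ξ ↦ (hKc ξ).continuousWithinAt)

/-- **Clause (ii) of the repaired Prop. 4.1, with the `𝓕`-side export**: for `a > 0` and `G, H`
holomorphic off `s = 1`, `Γℝ(s)H(s) = Γℝ(1−s)G(1−s)` off the poles of the `Γ`-factors, `G` and `H`
both in `(s/(s−1))A^sℍ²` (pole-tolerant form), there is `f ∈ L_a` with `f̂(s) = G(s)` AND
`(𝓕f)^(s) = H(s)` on `½ < Re s < 1` ("it is the Mellin transform of an element of
`ℂ·𝟙_{0<t<a} + L²(a,∞;dt)` … if moreover `χ(s)F(1−s)` also belongs to `(s/(s−1))A^sℍ²` … `f ∈ L_a`").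
[cite: Burnol2004b, Prop. 4.1 (arXiv:math/0203120v7 p. 7, TeX l.646–669)] -/
theorem Burnol2004b_prop4_1R_ii_fourier {a : ℝ} (ha : 0 < a) {G H : ℂ → ℂ}
    (hG : DifferentiableOn ℂ G {s | s ≠ 1}) (hH : DifferentiableOn ℂ H {s | s ≠ 1})
    (hFE : ∀ s : ℂ, (∀ n : ℕ, s ≠ -2 * (n : ℂ)) → (∀ n : ℕ, s ≠ 1 + 2 * (n : ℂ)) →
      Gammaℝ s * H s = Gammaℝ (1 - s) * G (1 - s))
    (hG2 : ∃ F : ℂ → ℂ, IsHardyRight F ∧ ∀ s : ℂ, 1 / 2 < s.re → s ≠ 1 →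
      F s = (a : ℂ) ^ s * ((s - 1) / s) * G s)
    (hH2 : ∃ F : ℂ → ℂ, IsHardyRight F ∧ ∀ s : ℂ, 1 / 2 < s.re → s ≠ 1 →
      F s = (a : ℂ) ^ s * ((s - 1) / s) * H s) :
    ∃ f ∈ sonineL a, (∀ s : ℂ, 1 / 2 < s.re → s.re < 1 → rightMellin f s = G s) ∧
      ∀ s : ℂ, 1 / 2 < s.re → s.re < 1 →
        rightMellin ((𝓕 f : Lp ℂ 2 (volume : Measure ℝ)) : ℝ → ℂ) s = H s :=
  BurnolHardyConverse.exists_mem_sonineL_of_boundaryValues ha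
    (fun hk2 hk0 _ hK hKc ↦ BurnolHardyConverse.boundaryValues ha hk2 hk0 hK hKc) hG hH hFE hG2 hH2

/-- **Clause (ii) of the repaired Prop. 4.1 (`Burnol2004b_prop4_1R`), free-standing and verbatim**:
"a function `G` holomorphic on `ℂ ∖ {1}` such that `G` and its 'Fourier transform' `H`
(`Γ_ℝ(s)H(s) = Γ_ℝ(1−s)G(1−s)`) both lie in `(s/(s−1))A^s ℍ²` is `f̂` for some `f ∈ L_a`" — the shape
consumed by `BurnolZetaHardy.Burnol2004b_prop4_2_of_prop4_1R_ii` and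
`BurnolSonineHardy.Burnol2004b_lemma4_4_of_prop4_1R_ii`.
[cite: Burnol2004b, Prop. 4.1 (arXiv:math/0203120v7 p. 7, TeX l.646–669)] -/
theorem Burnol2004b_prop4_1R_ii :
    ∀ a : ℝ, 0 < a → ∀ G H : ℂ → ℂ,
      DifferentiableOn ℂ G {s | s ≠ 1} → DifferentiableOn ℂ H {s | s ≠ 1} →
      (∀ s : ℂ, (∀ n : ℕ, s ≠ -2 * (n : ℂ)) → (∀ n : ℕ, s ≠ 1 + 2 * (n : ℂ)) →
        Gammaℝ s * H s = Gammaℝ (1 - s) * G (1 - s)) →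
      (∃ F : ℂ → ℂ, IsHardyRight F ∧ ∀ s : ℂ, 1 / 2 < s.re → s ≠ 1 →
        F s = (a : ℂ) ^ s * ((s - 1) / s) * G s) →
      (∃ F : ℂ → ℂ, IsHardyRight F ∧ ∀ s : ℂ, 1 / 2 < s.re → s ≠ 1 →
        F s = (a : ℂ) ^ s * ((s - 1) / s) * H s) →
      ∃ f ∈ sonineL a, ∀ s : ℂ, 1 / 2 < s.re → s.re < 1 → rightMellin f s = G s :=
  fun _ ha ↦ BurnolHardyConverse.prop4_1R_ii_of_boundaryValues ha
    (fun hk2 hk0 _ hK hKc ↦ BurnolHardyConverse.boundaryValues ha hk2 hk0 hK hKc)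

/-- **The repaired Prop. 4.1 (`Burnol2004b_prop4_1R`) holds AS TYPED**: (i) for `f ∈ L_a`, `f̂` and
`(𝓕f)^` lie in `(s/(s−1))A^sℍ²` (`Burnol2004b_prop4_1R_i`, `BurnolSonineHardyStrip.lean`); (ii) the
converse (`Burnol2004b_prop4_1R_ii` above); (iii) the regularity clause — at most a simple pole at
`s = 1`, zeros at `−2n`, `n ≥ 1` (`rightMellinExt_pole_and_zeros_of_mem_sonineL`,
`SonineExtendedMellinContinuation.lean`). Discharge of the named fact; the as-typed predecessor
`Burnol2004b_prop4_1` is refuted in the kernel (`Burnol2004b_prop4_1_false_of`, junk value at the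
removable singularity) and superseded by this record. [cite: Burnol2004b, Prop. 4.1 (arXiv:math/0203120v7 p. 7, TeX l.633–669)] -/
theorem Burnol2004b_prop4_1R_holds : Burnol2004b_prop4_1R :=
  fun a ha ↦ ⟨Burnol2004b_prop4_1R_i a ha, Burnol2004b_prop4_1R_ii a ha,
    fun _ hf ↦ rightMellinExt_pole_and_zeros_of_mem_sonineL ha hf⟩

/-- **Prop. 4.2 holds AS TYPED**: "The functions `ζ(s)/(s−ρ)^l`, `1 ≤ l ≤ m_ρ` associated with the
non-trivial zeros of the Riemann zeta function belong to `L̂_1`" — by the tree's reduction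
`BurnolZetaHardy.Burnol2004b_prop4_2_of_prop4_1R_ii` (the printed proof: `((s−1)/s)ζ(s)/s ∈ ℍ²`,
`χ(s)F(1−s) = (−1)^lζ(s)/(s−(1−ρ))^l`) applied to clause (ii). RH-FREE: a statement about every
non-trivial zero, wherever it lies. [cite: Burnol2004b, Prop. 4.2 (arXiv:math/0203120v7 p. 8, TeX l.688–707)] -/
theorem Burnol2004b_prop4_2_holds : Burnol2004b_prop4_2 :=
  BurnolZetaHardy.Burnol2004b_prop4_2_of_prop4_1R_ii Burnol2004b_prop4_1R_ii

end Literature.NumberTheory.LFunctions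

end
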